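import Mathlib
import Summits.Ventures.HodgeRepro.Tier4.Common.LocalTorusCompact
import Summits.Ventures.HodgeRepro.Tier4.Line4.ProjPlane

/-!
# Tier4/Common/LocalTorusCompactConj — the `T′`-side local torus of the SEESAW PLANE is compact at a real CM place

Blind re-derivation cell `pub-hodge-repro`, Tier 4 «prove the step» (README §9–§10), seat t4-typer-2 (gen 3).
Target tree path `lean/Summits/Ventures/HodgeRepro/Tier4/Common/LocalTorusCompactConj.lean`.  Mathlib +
`Common.LocalTorusCompact` + `Line4.ProjPlane` (plan-4's `hconj`: `g′ T′ g` is the torus of the row plane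
`mixedRow q a₁ a₃`); no literature.

WHY (t4-L4-p2 S13981: the per-place input «compactness of `localTorusAt' W w`»; t4-L4-p1 S14029 (α), `T′`-side):
on the seesaw plane `W' = (mixedRow q a₀ a₂).withTransportedTorus g g′` the transported local torus at `w` is
carried by `κ ↦ g′ κ g` INTO the local torus of the row plane `W₂ = mixedRow q a₁ a₃` at `w` (ProjPlane for the torus
part, `isAtPlace_conj` here for the support at `w`: `g, g′` are principal, so the components away from `w` stay the
identity), whose matrices lie in the compact `torusBox` (LocalTorusCompact); hence `mat κ = g (g′ κ g) g′` lies in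
the image of `torusBox` under the continuous map `M ↦ g M g′`, a compact set, for `κ` AND `κ⁻¹`; the closed set
`localTorusAt' W' w` is therefore a closed subset of a compact preimage under the closed embedding `g ↦ (g, g⁻¹)`.

* `map_conj_eq_one` — a ring-homomorphic image of `g′ M g` is `1` when that of `M` is;
* `isAtPlace_conj` — the conjugate of an element supported at `w` is supported at `w`;
* **`isCompact_localTorusAt'_seesaw`** — `IsCompact (localTorusAt' ((mixedRow q a₀ a₂).withTransportedTorus g g′ …) w)`
  under the wall's similitude display and `a 1 ≠ 0`, `a 3 ≠ 0`, `w.IsReal`, `IsCMAt q w`;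
* **`compactSpace_localTorusAt'_seesaw`** — the typeclass form.

Nothing here says anything about the status of the Hodge conjecture for CM abelian varieties, which is NOT proved
(HC_CM is NOT proved by anyone in this repository).
-/

set_option autoImplicit false

noncomputable section

namespace Summit.Ventures.HodgeRepro.Tier4.Common

open NumberField IsDedekindDomain Matrix Set Topology Summit.Ventures.HodgeRepro.Tier4.Line1

section Conj

variable {k : Type} [Field k] [NumberField k]

/-- A ring-homomorphic image of `g′ M g` is `1` when the image of `M` is `1` and `g′ g = 1`. -/
theorem map_conj_eq_one {R : Type} [CommRing R] (φ : Ad k →+* R) (g g' : Matrix (Fin 4) (Fin 4) k)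
    (hA' : adMat k g' * adMat k g = 1) {M : M4 k} (hM : M.map φ = 1) :
    (adMat k g' * M * adMat k g).map φ = 1 := by
  rw [Matrix.map_mul, Matrix.map_mul, hM, Matrix.mul_one, ← Matrix.map_mul, hA']
  exact Matrix.map_one _ (map_zero _) (map_one _)

/-- **The conjugate of an element supported at `w` is supported at `w`** (`g, g′` principal): for `κ' ∈ GA W₂` with
`mat κ' = g′ (mat κ) g` and `κ ∈ atPlace W' w`, `κ' ∈ atPlace W₂ w`. -/
theorem isAtPlace_conj {W' W₂ : PlaneData k} (g g' : Matrix (Fin 4) (Fin 4) k) (hA' : adMat k g' * adMat k g = 1)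
    {w : InfinitePlace k} {κ : GA W'} (hκ : IsAtPlace W' w κ) {κ' : GA W₂}
    (h : GA.mat W₂ κ' = adMat k g' * GA.mat W' κ * adMat k g) : IsAtPlace W₂ w κ' := by
  constructor
  · intro v
    rw [finiteComponent_eq_one_iff]
    intro i j
    have hM : (GA.mat W' κ).map (adComponentFin k v) = 1 := by
      apply Matrix.ext
      intro i' j'
      rw [Matrix.map_apply]
      exact (finiteComponent_eq_one_iff W' v κ).1 (hκ.1 v) i' j'
    have := congrFun (congrFun (map_conj_eq_one (adComponentFin k v) g g' hA' hM) i) j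
    rw [Matrix.map_apply] at this
    rw [h]
    exact this
  · intro w' hw'
    rw [infiniteComponent_eq_one_iff]
    intro i j
    have hM : (GA.mat W' κ).map (adComponentInf k w') = 1 := by
      apply Matrix.ext
      intro i' j'
      rw [Matrix.map_apply]
      exact (infiniteComponent_eq_one_iff W' w' κ).1 (hκ.2 w' hw') i' j'
    have := congrFun (congrFun (map_conj_eq_one (adComponentInf k w') g g' hA' hM) i) j
    rw [Matrix.map_apply] at this
    rw [h]
    exact this

/-- Conjugation `M ↦ g M g′` of adelic matrices is continuous. -/
theorem continuous_conjMat (g g' : Matrix (Fin 4) (Fin 4) k) :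
    Continuous fun M : M4 k => adMat k g * M * adMat k g' :=
  (continuous_const.matrix_mul continuous_id).matrix_mul continuous_const

end Conj

section Seesaw

variable {k : Type} [Field k] [NumberField k] (q : QuadData k) (a : Fin 4 → k)

/-- **THE `T′`-SIDE LOCAL TORUS OF THE SEESAW PLANE IS COMPACT** at a real CM place `w` (with `a 1 ≠ 0`, `a 3 ≠ 0`):
its elements are conjugate by `g` into the local torus of `mixedRow q a₁ a₃`, whose matrices lie in `torusBox`. -/
theorem isCompact_localTorusAt'_seesaw (g g' : Matrix (Fin 4) (Fin 4) k) (hgg' : g * g' = 1) (hg'g : g' * g = 1)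
    (hgΩ : g * (PlaneData.mixedRow q (a 0) (a 2)).Ω = (PlaneData.mixedRow q (a 0) (a 2)).Ω * g)
    (lam : k) (hlam : lam ≠ 0)
    (hiso : g * (PlaneData.mixedRow q (a 1) (a 3)).B * gᵀ = lam • (PlaneData.mixedRow q (a 0) (a 2)).B)
    (ha1 : a 1 ≠ 0) (ha3 : a 3 ≠ 0) {w : InfinitePlace k} (hw : w.IsReal) (hcm : IsCMAt q w) :
    IsCompact (localTorusAt' ((PlaneData.mixedRow q (a 0) (a 2)).withTransportedTorus g g' hgg' hg'g hgΩ) w :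
      Set (GA ((PlaneData.mixedRow q (a 0) (a 2)).withTransportedTorus g g' hgg' hg'g hgΩ))) := by
  have hA : adMat k g * adMat k g' = 1 := Line4.adMat_mul_adMat_eq_one g g' hgg'
  have hA' : adMat k g' * adMat k g = 1 := Line4.adMat_mul_adMat_eq_one g' g hg'g
  have hε : (-1 : k) ≠ 0 := neg_ne_zero.2 one_ne_zero
  -- the compact set of conjugated box matrices
  set K : Set (M4 k) := (fun M : M4 k => adMat k g * M * adMat k g') '' torusBox hw (blockBound q w) with hK
  have hKc : IsCompact K := (isCompact_torusBox hw (blockBound q w)).image (continuous_conjMat g g')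
  have hP : IsCompact (K ×ˢ (MulOpposite.op '' K)) := hKc.prod (hKc.image MulOpposite.continuous_op)
  have hpre : IsCompact ((fun x : GA ((PlaneData.mixedRow q (a 0) (a 2)).withTransportedTorus g g' hgg' hg'g hgΩ) =>
      Units.embedProduct (M4 k) (x : GL4 k)) ⁻¹' (K ×ˢ (MulOpposite.op '' K))) :=
    (isClosedEmbedding_embed _).isCompact_preimage hP
  refine hpre.of_isClosed_subset (isClosed_localTorusAt' _ w) ?_
  -- every element of the transported local torus has its matrix in `K`
  have hmem : ∀ κ ∈ localTorusAt' ((PlaneData.mixedRow q (a 0) (a 2)).withTransportedTorus g g' hgg' hg'g hgΩ) w,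
      GA.mat _ κ ∈ K := by
    intro κ hκ
    obtain ⟨κ', hκ'T, hκ'mat⟩ :=
      Line4.localTorusAt'_withTransportedTorus_conj q a g g' hgg' hg'g hgΩ lam hlam hiso w κ hκ
    have hκ'at : IsAtPlace (PlaneData.ofLinesRow q (a 1) (a 3) (-1)) w κ' := isAtPlace_conj g g' hA' hκ.2 hκ'mat
    have hκ'loc : κ' ∈ localTorusAt (PlaneData.ofLinesRow q (a 1) (a 3) (-1)) w := ⟨hκ'T, hκ'at⟩
    refine ⟨GA.mat _ κ', mem_torusBox_of_mem_localTorusAt q (a 1) (a 3) (-1) ha1 ha3 hε hw hcm hκ'loc, ?_⟩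
    rw [hκ'mat]
    calc adMat k g * (adMat k g' * GA.mat _ κ * adMat k g) * adMat k g'
        = (adMat k g * adMat k g') * GA.mat _ κ * (adMat k g * adMat k g') := by simp only [Matrix.mul_assoc]
      _ = GA.mat _ κ := by rw [hA, Matrix.one_mul, Matrix.mul_one]
  intro κ hκ
  show Units.embedProduct (M4 k) (κ : GL4 k) ∈ K ×ˢ (MulOpposite.op '' K)
  rw [Units.embedProduct_apply]
  refine ⟨hmem κ hκ, ?_⟩
  refine ⟨GA.mat _ κ⁻¹, hmem κ⁻¹ ((localTorusAt' _ w).inv_mem hκ), ?_⟩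
  rfl

/-- The typeclass form: the `T′`-side local torus of the seesaw plane is a compact space. -/
theorem compactSpace_localTorusAt'_seesaw (g g' : Matrix (Fin 4) (Fin 4) k) (hgg' : g * g' = 1) (hg'g : g' * g = 1)
    (hgΩ : g * (PlaneData.mixedRow q (a 0) (a 2)).Ω = (PlaneData.mixedRow q (a 0) (a 2)).Ω * g)
    (lam : k) (hlam : lam ≠ 0)
    (hiso : g * (PlaneData.mixedRow q (a 1) (a 3)).B * gᵀ = lam • (PlaneData.mixedRow q (a 0) (a 2)).B)
    (ha1 : a 1 ≠ 0) (ha3 : a 3 ≠ 0) {w : InfinitePlace k} (hw : w.IsReal) (hcm : IsCMAt q w) :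
    CompactSpace (localTorusAt' ((PlaneData.mixedRow q (a 0) (a 2)).withTransportedTorus g g' hgg' hg'g hgΩ) w) :=
  isCompact_iff_compactSpace.1
    (isCompact_localTorusAt'_seesaw q a g g' hgg' hg'g hgΩ lam hlam hiso ha1 ha3 hw hcm)

end Seesaw

end Summit.Ventures.HodgeRepro.Tier4.Common

end
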